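import Literature.AnabelianGeometry.SemiGraphs.TemperedCurveOfOpenSubgroupLevelData
import Literature.AnabelianGeometry.EtaleTheta.SingleUnderline
import HarnessLib

/-!
# The tempered curve `X̲_v` ([IUTchI] Def 3.1 (e); [EtTh] §2) as an instance of `TemperedCurve.ofOpenSubgroup`

S. Mochizuki, *Inter-universal Teichmüller Theory I*, kurims manuscript (May 2020), Def. 3.1 (e) p. 62 ("`X̲_v := X̲_K ×_K K_v`
… hyperbolic orbicurve of type `(1, l-tors)`"; [IUTchII] §2 Def. 2.3 (i) p. 67 "`Π^±_v := Π^tp_{X̲_v}`")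
[claim: Mochizuki2012, status: disputed] (D-0012 claim key; nothing of the series is asserted — a classical covering-theory
CONSTRUCTION over abc-iut-L2's [EtTh] data); *The étale theta function …* [EtTh] Def. 2.1 p. 36, Def. 2.5 (i) p. 39
(`Π^tp_X̲ ≤ Π^tp_X` open of index `l`, onto `G_K`) [cite: MochizukiEtTh2009, Def 2.5 (i) p.39].

MERGE BRIDGE (plan/L6/MERGE-MAP.md row **B15**, piece 1b; writer abc-iut-L6-t7 gen 3): the tempered-curve datum OF THE
COVERING `X̲_v → X_v` (`Π^tp := Π^tp_X̲ = GtpXu l`, `Π̂ :=` its closure in `Π_X`, base field `K` — abc-iut-L2-t7's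
`isOpen_GtpXu`, `index_GtpXu = l`, `map_aug_GtpXu = G_K`) — the curve over which abc-iut-L5's GENUINE [IUTchI] §2 datum
`StableCurveTemperedData.ofSpecialFibre` is formed for the comparison with the `±`-tower `PlusMinusTower.ofPiCHat`
([IUTchII] Def 2.3 (i), abc-iut-L6-t19 p430122) via abc-iut-w5-d132's `StableCurveAgreement.exists_of_isProfiniteCompletion`
(p430970).  The printed property «decomposition groups of `X̲_v` surject onto OPEN subgroups of `G_K`» ([SemiAnbd] §6 p. 71) enters
either as the named HYPOTHESIS `hDopen` (`temperedCurveXu`) or is DISCHARGED from compactness of the `D_x` (abc-iut-L3's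
`Thm68Sub.DecompCompact`, a theorem under `GroupLevelData` — `temperedCurveXuOfLevelData`, the form abc-iut-L5's
`StableCurveTemperedData.ofSpecialFibre X d S …` consumes anyway).  DEF-BEARING (post-freeze def, reading (ii)).
Nothing here takes a side on [IUTchIII] Cor. 3.12; constructed ≠ the paper's reconstruction algorithms.
-/

noncomputable section

namespace Literature.AnabelianGeometry.EtaleTheta

open Literature.AnabelianGeometry.SemiGraphs

namespace ThetaSetting

variable {p : ℕ} [Fact p.Prime] (D : ThetaSetting p) (l : ℕ)

/-- `aug(Π^tp_X̲) = G_K` in the shape `TemperedCurve.ofOpenSubgroup` asks (abc-iut-L2-t7's `map_aug_GtpXu`).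
[cite: MochizukiEtTh2009, Def 2.5 (i) p.39] -/
theorem range_aug_comp_GtpXu_subtype :
    (D.aug.toMonoidHom.comp (D.GtpXu l).subtype).range = D.K.fixingSubgroup := by
  rw [MonoidHom.range_comp, Subgroup.range_subtype]
  exact D.map_aug_GtpXu l

/-- **The tempered curve `X̲_v`** ([IUTchI] Def. 3.1 (e): type `(1, l-tors)`): abc-iut-L3's `TemperedCurve.ofOpenSubgroup` at the
open index-`l` subgroup `Π^tp_X̲ = GtpXu l ≤ Π^tp_X` with base field `K` (`X̲_v → X_v` is geometric: `aug(Π^tp_X̲) = G_K`), granted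
the printed openness `hDopen` of the images in `G_K` of the decomposition groups of `X̲_v`.  Its `PiTemp` is `↥(GtpXu l)`, its
`PiHat` the closure of `Π^tp_X̲` in `Π_X` (= `Π̂^±_v` of [IUTchII] Def. 2.3 (i) read inside `Π_X`), its inertia groups `≅ Ẑ`
(PROVED in piece 1). ([IUTchI] Def 3.1 (e), kurims p.62) [claim: Mochizuki2012, status: disputed] -/
def temperedCurveXu (hl : l ≠ 0)
    (hDopen : ∀ (x : D.Pt) (g : D.PiTemp),
      IsOpen (D.aug '' ((D.toTemperedCurve.decompOfOpenAt (D.GtpXu l) x g).map (D.GtpXu l).subtype : Set D.PiTemp))) :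
    TemperedCurve p :=
  haveI : (D.GtpXu l).FiniteIndex := ⟨by rw [D.index_GtpXu l]; exact hl⟩
  haveI : FiniteDimensional ℚ_[p] D.K := D.finiteDimensional_K
  D.toTemperedCurve.ofOpenSubgroup (D.GtpXu l) (D.isOpen_GtpXu l) D.K (D.range_aug_comp_GtpXu_subtype l) hDopen

/-- `Π^tp_{X̲_v} = GtpXu l` (`rfl`). ([IUTchI] Def 3.1 (e), kurims p.62) [claim: Mochizuki2012, status: disputed] -/
theorem temperedCurveXu_PiTemp (hl : l ≠ 0) (hDopen) : (D.temperedCurveXu l hl hDopen).PiTemp = ↥(D.GtpXu l) := rfl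

/-- `Π̂_{X̲_v}` is the closure of `Π^tp_X̲` in `Π_X` (`rfl`). ([IUTchI] Def 3.1 (e), kurims p.62) [claim: Mochizuki2012, status: disputed] -/
theorem temperedCurveXu_PiHat (hl : l ≠ 0) (hDopen) :
    (D.temperedCurveXu l hl hDopen).PiHat = ↥(D.toTemperedCurve.hatOfOpen (D.GtpXu l)) := rfl

/-- The base field of `X̲_v` is `K` (`rfl`). ([IUTchI] Def 3.1 (e), kurims p.62) [claim: Mochizuki2012, status: disputed] -/
theorem temperedCurveXu_K (hl : l ≠ 0) (hDopen) : (D.temperedCurveXu l hl hDopen).K = D.K := rfl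

/-- The augmentation of `X̲_v` is the restriction of that of `X` (`rfl`). ([IUTchI] Def 3.1 (e), kurims p.62) [claim: Mochizuki2012, status: disputed] -/
theorem temperedCurveXu_aug_apply (hl : l ≠ 0) (hDopen) (h : D.GtpXu l) :
    (D.temperedCurveXu l hl hDopen).aug h = D.aug h := rfl

/-- `Π^tp_{X̲_v} → Π̂_{X̲_v}` IS a profinite completion — input (b) of abc-iut-w5-d132's `StableCurveAgreement.exists_of_isProfiniteCompletion`
for the [IUTchI] §2 datum of `X̲_v`. ([IUTchI] Def 3.1 (e), kurims p.62) [claim: Mochizuki2012, status: disputed] -/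
theorem isProfiniteCompletion_temperedCurveXu_toHat (hl : l ≠ 0) (hDopen) :
    IsProfiniteCompletion (D.temperedCurveXu l hl hDopen).toHat :=
  (D.temperedCurveXu l hl hDopen).isProfiniteCompletion_toHat

/-- **The tempered curve `X̲_v`, hypothesis-free form over `GroupLevelData`**: the openness of the images in `G_K` of the
decomposition groups of `X̲_v` is DISCHARGED from the compactness of the `D_x` (`decompCompact_of_groupLevelData` +
piece 1's `hDopen_of_isCompact_decomp`) — `d : GroupLevelData` is the very parameter bundle abc-iut-L5's `ofSpecialFibre`
takes. ([IUTchI] Def 3.1 (e), kurims p.62) [claim: Mochizuki2012, status: disputed] -/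
def temperedCurveXuOfLevelData (hl : l ≠ 0) (d : D.toTemperedCurve.GroupLevelData) : TemperedCurve p :=
  D.temperedCurveXu l hl (D.toTemperedCurve.hDopen_of_isCompact_decomp (D.GtpXu l) (D.isOpen_GtpXu l)
    (D.toTemperedCurve.decompCompact_of_groupLevelData d))

/-- `Π^tp_{X̲_v} = GtpXu l` for the `GroupLevelData` form (`rfl`). ([IUTchI] Def 3.1 (e), kurims p.62) [claim: Mochizuki2012, status: disputed] -/
theorem temperedCurveXuOfLevelData_PiTemp (hl : l ≠ 0) (d : D.toTemperedCurve.GroupLevelData) :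
    (D.temperedCurveXuOfLevelData l hl d).PiTemp = ↥(D.GtpXu l) := rfl

/-- `Π^tp_{X̲_v} → Π̂_{X̲_v}` is a profinite completion, `GroupLevelData` form. ([IUTchI] Def 3.1 (e), kurims p.62) [claim: Mochizuki2012, status: disputed] -/
theorem isProfiniteCompletion_temperedCurveXuOfLevelData_toHat (hl : l ≠ 0) (d : D.toTemperedCurve.GroupLevelData) :
    IsProfiniteCompletion (D.temperedCurveXuOfLevelData l hl d).toHat :=
  (D.temperedCurveXuOfLevelData l hl d).isProfiniteCompletion_toHat

/-- **The parameter bundle of `X̲_v` from that of `X_v`**: `GroupLevelData` of the covering (temperedness / temp-slimness of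
`Π^tp_X̲`, `Δ^tp_X̲`, Galois-countability, the same `G_K ≃ Gal(K̄/K)`) induced from `d` (piece 1d
`TemperedCurve.GroupLevelData.ofOpenSubgroup`) — so abc-iut-L5's `ofSpecialFibre` at `X̲_v` needs only the special-fibre data.
([IUTchI] Def 3.1 (e), kurims p.62) [claim: Mochizuki2012, status: disputed] -/
def groupLevelDataXu (hl : l ≠ 0) (d : D.toTemperedCurve.GroupLevelData) :
    (D.temperedCurveXuOfLevelData l hl d).GroupLevelData :=
  haveI : (D.GtpXu l).FiniteIndex := ⟨by rw [D.index_GtpXu l]; exact hl⟩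
  haveI : FiniteDimensional ℚ_[p] D.K := D.finiteDimensional_K
  TemperedCurve.GroupLevelData.ofOpenSubgroup D.toTemperedCurve (D.GtpXu l) (D.isOpen_GtpXu l)
    (D.range_aug_comp_GtpXu_subtype l)
    (D.toTemperedCurve.hDopen_of_isCompact_decomp (D.GtpXu l) (D.isOpen_GtpXu l)
      (D.toTemperedCurve.decompCompact_of_groupLevelData d)) d

end ThetaSetting

end Literature.AnabelianGeometry.EtaleTheta

end
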